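import Summits.BirchSwinnertonDyer.Rank1Residual.Additive.RamifiedSevenIntegralComparisonOfInputs
import HarnessLib

set_option autoImplicit false

/-!
# `𝒞₇` genus road (crux `EllipticUnitValueSevenOfGZK`, K7r), row (K2C-2): THE K2ᶜ DIVISIBILITY INPUT AS AN INTEGER INEQUALITY
# — in-tree PORT of bsd-idea-20 g65's crux workfile `Cruxes/EllipticUnitValueSevenOfGZK/FbKernelInteger_g65.lean` REV 1.2
# (tree sha16 b1b955ebc621bb75; REV 1.1 commit 89d7e2492c88; critic idea-crit-15 g14 V#22cr PASS, 0 price), so that Additive files and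
# the K2ᶜ existence/typing programme can IMPORT it (workfiles are not importable — pen D921 (2): «re-prove the ~90 lines in an
# Additive file if wanted in-tree … typer's call»).  THEOREMS + two `Prop` letters; no named fact; debt 0.

Cell bsd-cm, seat bsd-cm-prr-ty1 g30 (literature-prover); AUTHOR OF THE MATHEMATICS AND OF THE LEAN TEXT BELOW: bsd-idea-20 g65
(K2ᶜ author of record) — this file reproduces §1–§3 of the workfile verbatim up to the namespace (`…GenusSeven.PeriodPosition`
instead of `…GenusSeven.FbKernelInteger`, to keep fully-qualified names distinct from the compiled workfile) and this header.

WHAT IT SAYS.  Block (R) (p782019) proved `π^{m₀+2jα} • EU_𝔟 = ((wα⁻¹·cZ·t′)·x̃_𝔟) • 𝐳_{γ′}` with the EXPLICIT constant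
`D.cZ = (α₀ − α₁π)·7^e·uStar⁻¹·7^k·u·π^a` (p781874), and the assembly (p782137) turned the v12 stub into the input form whose one
non-structural conjunct is the divisibility `Φ.π ^ (m₀ + 2·D.jα) ∣ D.cZ * t′`.  Here (§1, pure algebra in any commutative ring with
`7 = v·π²`): `7^j ∣ α₀² + 7α₁² ⟹ π^j ∣ α₀ − α₁π` (induction with step 2), whence (§2, on the landed datum) the divisibility FOLLOWS
from ONE inequality of naturals — `PeriodPositionFieldAt D m₀ m′ : m₀ + D.jα ≤ 2·D.e + 2·Φ.k + Φ.a + m′` for a cofactor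
`t′ = w′·π^{m′}`, or `PeriodPositionField D : D.jα ≤ 2·D.e + 2·Φ.k + Φ.a` in the unit-`t` gauge — and (§3) the assembly's
`integralComparisonShape_of_inputs` / the v12 stub letter hold with `hKI` so replaced (★″ `integralComparisonSeven_of_periodPositionInputs`).
The (F-b) pre-registration (`FbPreregistration-g65.md` §2bis, critic PASS) predicts EQUALITY `D.jα = 2·D.e + 2·Φ.k + Φ.a` on genuine data.

HONEST LABEL: algebra and conditional theorems; the letters are predicates, nothing is asserted; whether a genuine datum satisfies
`PeriodPositionField` is a pre-registered prediction, not a theorem; no stub of zp v13 closes; no summit statement is proved by this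
seat; 19945 OPEN (5 sorries); `X12.CMRamifiedSeven` NOT proved; BSD is claimed for no curve.

References: K. Kato, Astérisque 295 (2004) §15.16 (15.16.1) (p. 265), 15.14 (p. 264), Thm. 12.4 (2) (p. 221) [Kato2004Asterisque];
bsd-idea-20 g65 `FbKernelInteger_g65.lean` REV 1.2 / `FbPreregistration-g65.md`; pen D916/D918/D921; p781874, p782019, p782137.
-/

namespace Summit.BirchSwinnertonDyer.Rank1Residual.Additive.GenusSeven.PeriodPosition

section Divisibility

variable {R : Type*} [CommRing R]

/-- **`π^j ∣ α₀ − α₁π` whenever `7^j ∣ α₀² + 7α₁²`**, in any commutative ring with `7 = v·π²`.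
[cite: Kato2004Asterisque, (15.16.1) (p. 265)] -/
theorem pow_dvd_intCast_sub_intCast_mul (π v : R) (h7 : (7 : R) = v * π ^ 2) :
    ∀ (j : ℕ) (α₀ α₁ : ℤ), (7 : ℤ) ^ j ∣ α₀ ^ 2 + 7 * α₁ ^ 2 → π ^ j ∣ ((α₀ : R) - (α₁ : R) * π) := by
  have h7p : Prime (7 : ℤ) := Int.prime_iff_natAbs_prime.2 (by norm_num)
  intro j
  induction j using Nat.strong_induction_on with
  | _ j ih =>
    intro α₀ α₁ hdvd
    match j, ih, hdvd with
    | 0, _, _ => exact ⟨(α₀ : R) - (α₁ : R) * π, by ring⟩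
    | 1, _, hdvd =>
      have h7N : (7 : ℤ) ∣ α₀ ^ 2 + 7 * α₁ ^ 2 := by simpa using hdvd
      have h7a : (7 : ℤ) ∣ α₀ ^ 2 := (dvd_add_left (dvd_mul_right (7 : ℤ) (α₁ ^ 2))).mp h7N
      obtain ⟨a, rfl⟩ := h7p.dvd_of_dvd_pow h7a
      refine ⟨v * π * (a : R) - (α₁ : R), ?_⟩
      push_cast
      rw [h7]
      ring
    | j + 2, ih, hdvd =>
      have h7N : (7 : ℤ) ∣ α₀ ^ 2 + 7 * α₁ ^ 2 :=
        (dvd_pow_self (7 : ℤ) (by omega : j + 2 ≠ 0)).trans hdvd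
      have h7a : (7 : ℤ) ∣ α₀ ^ 2 := (dvd_add_left (dvd_mul_right (7 : ℤ) (α₁ ^ 2))).mp h7N
      obtain ⟨a, rfl⟩ := h7p.dvd_of_dvd_pow h7a
      have h49 : (7 : ℤ) ^ 2 ∣ (7 * a) ^ 2 + 7 * α₁ ^ 2 :=
        (pow_dvd_pow (7 : ℤ) (by omega : 2 ≤ j + 2)).trans hdvd
      have h49' : (7 : ℤ) * 7 ∣ 7 * α₁ ^ 2 := by
        have h1 : (7 : ℤ) ^ 2 ∣ (7 * a) ^ 2 := ⟨a ^ 2, by ring⟩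
        have h2 := (dvd_add_right h1).mp h49
        simpa [pow_two] using h2
      have h7b2 : (7 : ℤ) ∣ α₁ ^ 2 := (mul_dvd_mul_iff_left (by norm_num : (7 : ℤ) ≠ 0)).mp h49'
      obtain ⟨b, rfl⟩ := h7p.dvd_of_dvd_pow h7b2
      have hj : (7 : ℤ) ^ j ∣ a ^ 2 + 7 * b ^ 2 := by
        have h1 : (7 : ℤ) ^ (j + 2) = 7 ^ 2 * 7 ^ j := by ring
        have h2 : (7 * a) ^ 2 + 7 * (7 * b) ^ 2 = (7 : ℤ) ^ 2 * (a ^ 2 + 7 * b ^ 2) := by ring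
        rw [h1, h2] at hdvd
        exact (mul_dvd_mul_iff_left (by positivity : (7 : ℤ) ^ 2 ≠ 0)).mp hdvd
      obtain ⟨c, hc⟩ := ih j (by omega) a b hj
      refine ⟨v * c, ?_⟩
      push_cast
      have h3 : (7 : R) * (a : R) - 7 * (b : R) * π = 7 * ((a : R) - (b : R) * π) := by ring
      rw [h3, hc, h7]
      ring

/-- `7^{jα} ∣ α₀² + 7α₁²` for `jα := (α₀² + 7α₁²).toNat.factorization 7` — the letter of `DualExpValueDatum.jα`/`normA`.
[cite: Kato2004Asterisque, (15.16.1) (p. 265)] -/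
theorem seven_pow_factorization_dvd_norm (α₀ α₁ : ℤ) :
    (7 : ℤ) ^ ((α₀ ^ 2 + 7 * α₁ ^ 2).toNat.factorization 7) ∣ α₀ ^ 2 + 7 * α₁ ^ 2 := by
  set n : ℕ := (α₀ ^ 2 + 7 * α₁ ^ 2).toNat with hn
  have hnn : (0 : ℤ) ≤ α₀ ^ 2 + 7 * α₁ ^ 2 := by positivity
  have hcast : (n : ℤ) = α₀ ^ 2 + 7 * α₁ ^ 2 := Int.toNat_of_nonneg hnn
  have h : 7 ^ n.factorization 7 ∣ n := Nat.ordProj_dvd n 7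
  have h' : ((7 ^ n.factorization 7 : ℕ) : ℤ) ∣ (n : ℤ) := Int.natCast_dvd_natCast.mpr h
  rw [hcast] at h'
  exact_mod_cast h'

/-- **The D916 divisibility input from an integer inequality (general `t`-gauge).**  With `jα := v₇(α₀² + 7α₁²)`
(as `.toNat.factorization 7`), `cZ := (α₀ − α₁π)·7^e·(w·(7^k·(u·π^a)))` (the body of `DualExpValueDatum.cZ`) and
`t′ = w′·π^{m′}`:  `m₀ + 2jα ≤ jα + (2e + 2k + a) + m′ ⟹ π^(m₀ + 2jα) ∣ cZ·t′`.  No unit hypothesis on `v, w, u, w′` is needed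
for this direction. [cite: Kato2004Asterisque, (15.16.1) (p. 265)] -/
theorem pow_dvd_constZ_mul_of_le (π v : R) (h7 : (7 : R) = v * π ^ 2) (α₀ α₁ : ℤ) (e k a m₀ m' : ℕ)
    (w u w' : R)
    (hle : m₀ + 2 * (α₀ ^ 2 + 7 * α₁ ^ 2).toNat.factorization 7 ≤
      (α₀ ^ 2 + 7 * α₁ ^ 2).toNat.factorization 7 + (2 * e + 2 * k + a) + m') :
    π ^ (m₀ + 2 * (α₀ ^ 2 + 7 * α₁ ^ 2).toNat.factorization 7) ∣
      ((((α₀ : R) - (α₁ : R) * π) * (7 : R) ^ e) * (w * ((7 : R) ^ k * (u * π ^ a)))) * (w' * π ^ m') := by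
  set j : ℕ := (α₀ ^ 2 + 7 * α₁ ^ 2).toNat.factorization 7 with hj
  obtain ⟨c, hc⟩ := pow_dvd_intCast_sub_intCast_mul π v h7 j α₀ α₁ (seven_pow_factorization_dvd_norm α₀ α₁)
  have hpow : π ^ (m₀ + 2 * j) ∣ π ^ (j + (2 * e + 2 * k + a) + m') := pow_dvd_pow π hle
  have hshape : ((((α₀ : R) - (α₁ : R) * π) * (7 : R) ^ e) * (w * ((7 : R) ^ k * (u * π ^ a)))) * (w' * π ^ m') =
      π ^ (j + (2 * e + 2 * k + a) + m') * (c * v ^ e * w * v ^ k * u * w') := by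
    rw [hc, h7]
    ring
  rw [hshape]
  exact hpow.mul_right _

/-- **The `t = t′ = 1`, `m₀ = 0` gauge** (FEXISTS addendum `t := 1`, pen D907): `jα ≤ 2e + 2k + a ⟹ π^(2jα) ∣ cZ` — the
hypothesis is the (F-b) pre-registration's `PeriodPositionField` verbatim (`FbPreregistration-g65.md` §5), predicted to hold
with EQUALITY `jα = 2(e+k) + a_W` on genuine data (§2 (P1)). [cite: Kato2004Asterisque, (15.16.1) (p. 265)] -/
theorem pow_dvd_constZ_of_le (π v : R) (h7 : (7 : R) = v * π ^ 2) (α₀ α₁ : ℤ) (e k a : ℕ) (w u : R)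
    (hle : (α₀ ^ 2 + 7 * α₁ ^ 2).toNat.factorization 7 ≤ 2 * e + 2 * k + a) :
    π ^ (2 * (α₀ ^ 2 + 7 * α₁ ^ 2).toNat.factorization 7) ∣
      (((α₀ : R) - (α₁ : R) * π) * (7 : R) ^ e) * (w * ((7 : R) ^ k * (u * π ^ a))) := by
  have h := pow_dvd_constZ_mul_of_le π v h7 α₀ α₁ e k a 0 0 w u 1 (by omega)
  simpa using h

end Divisibility

end Summit.BirchSwinnertonDyer.Rank1Residual.Additive.GenusSeven.PeriodPosition

/-! ## §2 The letter on the datum: `PeriodPositionField D ⟹ Φ.π ^ (m₀ + 2·D.jα) ∣ D.cZ * t′`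

Over the tree's `DualExpValueDatum hγ Φ` (p781874): the (F-b) pre-registration's datum-side letter (memo §5) in the datum's own named
naturals, and the D916 divisibility input derived from it through §1.  `D.cZ`, `D.jα`, `D.normA`, `D.e`, `D.uStar`, `Φ.k`, `Φ.a`, `Φ.u`,
`Φ.v`, `Φ.π`, `Φ.seven_eq` are the TREE's declarations (nothing re-declared); the only new definitions are the two `Prop` letters.
HONEST LABEL: the letters are predicates and the theorems are algebra; whether a genuine datum satisfies `PeriodPositionField` is the
PRE-REGISTERED PREDICTION (P1′) of `FbPreregistration-g65.md` §2bis (predicted with EQUALITY), not a theorem here. -/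

namespace Summit.BirchSwinnertonDyer.Rank1Residual.Additive.GenusSeven

open scoped NumberField TensorProduct
open Field IsDedekindDomain NumberField
open Literature.NumberTheory.GaloisRepresentations
open Literature.NumberTheory.EllipticCurves
open Literature.NumberTheory.EllipticCurves.Rank1Residual
open Literature.NumberTheory.EllipticCurves.IwasawaAlgebra
open Literature.NumberTheory.EllipticCurves.Kato2004
open Literature.NumberTheory.ComplexMultiplication.EllipticUnits
open Summit.BirchSwinnertonDyer.Rank1Residual

section Datum

variable {W : WeierstrassCurve ℚ} [W.IsElliptic] [W.IsGloballyMinimal] [Fact (Nat.Prime 7)]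
  [ContinuousSMul ℤ_[7] (W.tateModule 7)] {K : ZpExtension ℚ 7} {hK : K.IsCyclotomic}
  {γ : Field.absoluteGaloisGroup ℚ} {I : IwasawaH1Data W 7 K γ}
  {F : GenusFrame} {θu : ∀ n : ℕ, globalUnitsOf (F.layer n)} {d : GenusDatum F θu}
  {hγ : K.IsTopGenerator γ} {Φ : PinnedKatoGenusFrame W K hK I d}

namespace PeriodPosition

/-- **`PeriodPositionField D`** (t-unit gauge, FEXISTS `t := 1`): `v₇(N(α)) ≤ 2e + 2k + a` in the datum's named naturals —
`D.jα ≤ 2·D.e + 2·Φ.k + Φ.a`.  The (F-b) pre-registration predicts EQUALITY on genuine data (`FbPreregistration-g65.md` §2bis (P1′)).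
A predicate; nothing asserted. [cite: Kato2004Asterisque, (15.16.1) (p. 265)] -/
def PeriodPositionField (D : DualExpValueDatum hγ Φ) : Prop :=
  D.jα ≤ 2 * D.e + 2 * Φ.k + Φ.a

/-- **`PeriodPositionFieldAt D m₀ m′`** (general `t`-gauge): with `Φ.t * t′ = Φ.π ^ m₀` and `t′ = w′·Φ.π ^ m′` (so `m₀ − m′ = v_π(t)`),
`D.jα + (m₀ − m′) ≤ 2·D.e + 2·Φ.k + Φ.a`, written subtraction-free.  A predicate; nothing asserted.
[cite: Kato2004Asterisque, (15.16.1) (p. 265)] -/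
def PeriodPositionFieldAt (D : DualExpValueDatum hγ Φ) (m₀ m' : ℕ) : Prop :=
  m₀ + D.jα ≤ 2 * D.e + 2 * Φ.k + Φ.a + m'

/-- The two gauges agree at `m₀ = m′` (in particular at `t = t′ = 1`, `m₀ = m′ = 0`). [cite: Kato2004Asterisque, (15.16.1) (p. 265)] -/
theorem periodPositionFieldAt_self_iff (D : DualExpValueDatum hγ Φ) (m : ℕ) :
    PeriodPositionFieldAt D m m ↔ PeriodPositionField D := by
  unfold PeriodPositionFieldAt PeriodPositionField
  omega

/-- `D.cZ` with its casts normalised: `(α₀ − α₁π)·7^e·(A(uStar⁻¹)·(7^k·(u·π^a)))`. [cite: Kato2004Asterisque, (15.16.1) (p. 265)] -/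
theorem cZ_eq (D : DualExpValueDatum hγ Φ) :
    D.cZ = (((D.α₀ : Φ.R) - (D.α₁ : Φ.R) * Φ.π) * (7 : Φ.R) ^ D.e) *
      (algebraMap (IwasawaAlgebra 7) Φ.R (↑(D.uStar⁻¹) : IwasawaAlgebra 7) *
        ((7 : Φ.R) ^ Φ.k * ((Φ.u : Φ.R) * Φ.π ^ Φ.a))) := by
  simp only [DualExpValueDatum.cZ, map_intCast, map_pow, map_ofNat, Int.cast_pow, Int.cast_ofNat]

/-- **The D916 divisibility input from the integer inequality, general gauge**: for any cofactor `t′ = w′·π^{m′}`,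
`PeriodPositionFieldAt D m₀ m′ ⟹ Φ.π ^ (m₀ + 2·D.jα) ∣ D.cZ * t′`.  (The hypothesis `Φ.t * t′ = Φ.π ^ m₀` of block (R) is not even
needed for this direction.) [cite: Kato2004Asterisque, (15.16.1) (p. 265)] -/
theorem pow_dvd_cZ_mul_of_periodPositionFieldAt (D : DualExpValueDatum hγ Φ) (t' w' : Φ.R) (m₀ m' : ℕ)
    (ht' : t' = w' * Φ.π ^ m') (h : PeriodPositionFieldAt D m₀ m') :
    Φ.π ^ (m₀ + 2 * D.jα) ∣ D.cZ * t' := by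
  have hle : m₀ + 2 * (D.α₀ ^ 2 + 7 * D.α₁ ^ 2).toNat.factorization 7 ≤
      (D.α₀ ^ 2 + 7 * D.α₁ ^ 2).toNat.factorization 7 + (2 * D.e + 2 * Φ.k + Φ.a) + m' := by
    change m₀ + 2 * D.jα ≤ D.jα + (2 * D.e + 2 * Φ.k + Φ.a) + m'
    unfold PeriodPositionFieldAt at h
    omega
  have key := PeriodPosition.pow_dvd_constZ_mul_of_le Φ.π (Φ.v : Φ.R) Φ.seven_eq D.α₀ D.α₁ D.e Φ.k Φ.a m₀ m'
    (algebraMap (IwasawaAlgebra 7) Φ.R (↑(D.uStar⁻¹) : IwasawaAlgebra 7)) (Φ.u : Φ.R) w' hle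
  rw [cZ_eq, ht']
  exact key

/-- **The `t = t′ = 1` gauge**: `PeriodPositionField D ⟹ Φ.π ^ (2·D.jα) ∣ D.cZ`. [cite: Kato2004Asterisque, (15.16.1) (p. 265)] -/
theorem pow_dvd_cZ_of_periodPositionField (D : DualExpValueDatum hγ Φ) (h : PeriodPositionField D) :
    Φ.π ^ (2 * D.jα) ∣ D.cZ := by
  have h1 := pow_dvd_cZ_mul_of_periodPositionFieldAt D 1 1 0 0 (by simp) ((periodPositionFieldAt_self_iff D 0).2 h)
  simpa using h1

/-- With block (R)'s cofactor hypothesis `Φ.t * t′ = Φ.π ^ m₀` and a unit `t` (`t′ = w′·π^{m₀}`, the (C-t) gauge of the memo),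
the t-unit letter suffices: `PeriodPositionField D ⟹ Φ.π ^ (m₀ + 2·D.jα) ∣ D.cZ * t′`. [cite: Kato2004Asterisque, (15.16.1) (p. 265)] -/
theorem pow_dvd_cZ_mul_of_periodPositionField (D : DualExpValueDatum hγ Φ) (t' w' : Φ.R) (m₀ : ℕ)
    (ht' : t' = w' * Φ.π ^ m₀) (h : PeriodPositionField D) :
    Φ.π ^ (m₀ + 2 * D.jα) ∣ D.cZ * t' :=
  pow_dvd_cZ_mul_of_periodPositionFieldAt D t' w' m₀ m₀ ht' ((periodPositionFieldAt_self_iff D m₀).2 h)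

/-! ### §3 The assembly's inputs with the divisibility replaced by the (F-b) letter -/

/-- In the unit-`t` gauge ((C-t); FEXISTS `t := 1` is the case `t = 1`), block (R)'s cofactor identity `Φ.t * t′ = Φ.π ^ m₀` gives
`t′ = t⁻¹·π^{m₀}`. [cite: Kato2004Asterisque, (15.16.1) (p. 265)] -/
theorem cofactor_eq_of_isUnit {t' : Φ.R} {m₀ : ℕ} (ht : Φ.t * t' = Φ.π ^ m₀) (htu : IsUnit Φ.t) :
    t' = (↑(htu.unit⁻¹) : Φ.R) * Φ.π ^ m₀ :=
  calc t' = ((↑(htu.unit⁻¹) : Φ.R) * Φ.t) * t' := by rw [IsUnit.val_inv_mul, one_mul]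
    _ = (↑(htu.unit⁻¹) : Φ.R) * (Φ.t * t') := mul_assoc _ _ _
    _ = (↑(htu.unit⁻¹) : Φ.R) * Φ.π ^ m₀ := by rw [ht]

/-- **`integralComparisonShape_of_inputs` with `hKI` replaced by `IsUnit Φ.t ∧ PeriodPositionField D`** (unit-`t` gauge).
CONDITIONAL; nothing asserted; 19945 OPEN. [cite: Kato2004Asterisque, (15.16.1) (p. 265), 15.14 (p. 264), Thm. 12.4 (2) (p. 221)] -/
theorem integralComparisonShape_of_inputs_of_periodPositionField (hγ : K.IsTopGenerator γ)
    (Φ : PinnedKatoGenusFrame W K hK I d)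
    (D : DualExpValueDatum hγ Φ) (t' : Φ.R) (m₀ : ℕ) (ht : Φ.t * t' = Φ.π ^ m₀)
    (htf : ∀ (f : IwasawaAlgebra 7) (x : Φ.IK.H), f ≠ 0 → f • x = 0 → x = 0)
    (hrk : ∀ x y : Φ.IK.H, ∃ s r₀ r₁ : IwasawaAlgebra 7,
      (s ≠ 0 ∨ r₀ ≠ 0 ∨ r₁ ≠ 0) ∧ s • x = r₀ • y + r₁ • Φ.piK y)
    (hχ : ∀ n : ℕ, ∃ χ : absoluteGaloisGroup Φ.Kcm →ₜ* ℂˣ,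
      (∀ σ ∈ (K.restrictOfFinrankEqTwo (by decide) Φ.Kcm Φ.finrank_Kcm).layerSubgroup (n + 1), χ σ = 1) ∧
        IsPrimitiveRoot (((χ Φ.γK : ℂˣ)) : ℂ) (7 ^ (n + 1)))
    (hL : ∀ χ : absoluteGaloisGroup Φ.Kcm →ₜ* ℂˣ, ∃ Lf : ℂ → ℂ, CM.IsDepletedHeckeL Φ.ψ χ (7 * (7 * F.d)) Lf)
    (hRoh : ∃ n₁ : ℕ, ∀ n : ℕ, n₁ ≤ n → ∀ χ : absoluteGaloisGroup Φ.Kcm →ₜ* ℂˣ,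
      (∀ σ ∈ (K.restrictOfFinrankEqTwo (by decide) Φ.Kcm Φ.finrank_Kcm).layerSubgroup (n + 1), χ σ = 1) →
      IsPrimitiveRoot (((χ Φ.γK : ℂˣ)) : ℂ) (7 ^ (n + 1)) →
      ∀ Lf : ℂ → ℂ, CM.IsDepletedHeckeL Φ.ψ χ (7 * (7 * F.d)) Lf → Lf 1 ≠ 0)
    (htu : IsUnit Φ.t) (hPP : PeriodPositionField D) :
    IntegralComparisonShape Φ :=
  integralComparisonShape_of_inputs hγ Φ D t' m₀ ht htf hrk hχ hL hRoh
    (pow_dvd_cZ_mul_of_periodPositionField D t' _ m₀ (cofactor_eq_of_isUnit ht htu) hPP)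

/-- **General gauge**: `hKI` replaced by a factorisation `t′ = w′·π^{m′}` and `PeriodPositionFieldAt D m₀ m′`.
CONDITIONAL; nothing asserted; 19945 OPEN. [cite: Kato2004Asterisque, (15.16.1) (p. 265), 15.14 (p. 264), Thm. 12.4 (2) (p. 221)] -/
theorem integralComparisonShape_of_inputs_of_periodPositionFieldAt (hγ : K.IsTopGenerator γ)
    (Φ : PinnedKatoGenusFrame W K hK I d)
    (D : DualExpValueDatum hγ Φ) (t' : Φ.R) (m₀ : ℕ) (ht : Φ.t * t' = Φ.π ^ m₀)
    (htf : ∀ (f : IwasawaAlgebra 7) (x : Φ.IK.H), f ≠ 0 → f • x = 0 → x = 0)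
    (hrk : ∀ x y : Φ.IK.H, ∃ s r₀ r₁ : IwasawaAlgebra 7,
      (s ≠ 0 ∨ r₀ ≠ 0 ∨ r₁ ≠ 0) ∧ s • x = r₀ • y + r₁ • Φ.piK y)
    (hχ : ∀ n : ℕ, ∃ χ : absoluteGaloisGroup Φ.Kcm →ₜ* ℂˣ,
      (∀ σ ∈ (K.restrictOfFinrankEqTwo (by decide) Φ.Kcm Φ.finrank_Kcm).layerSubgroup (n + 1), χ σ = 1) ∧
        IsPrimitiveRoot (((χ Φ.γK : ℂˣ)) : ℂ) (7 ^ (n + 1)))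
    (hL : ∀ χ : absoluteGaloisGroup Φ.Kcm →ₜ* ℂˣ, ∃ Lf : ℂ → ℂ, CM.IsDepletedHeckeL Φ.ψ χ (7 * (7 * F.d)) Lf)
    (hRoh : ∃ n₁ : ℕ, ∀ n : ℕ, n₁ ≤ n → ∀ χ : absoluteGaloisGroup Φ.Kcm →ₜ* ℂˣ,
      (∀ σ ∈ (K.restrictOfFinrankEqTwo (by decide) Φ.Kcm Φ.finrank_Kcm).layerSubgroup (n + 1), χ σ = 1) →
      IsPrimitiveRoot (((χ Φ.γK : ℂˣ)) : ℂ) (7 ^ (n + 1)) →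
      ∀ Lf : ℂ → ℂ, CM.IsDepletedHeckeL Φ.ψ χ (7 * (7 * F.d)) Lf → Lf 1 ≠ 0)
    (w' : Φ.R) (m' : ℕ) (ht' : t' = w' * Φ.π ^ m') (hPP : PeriodPositionFieldAt D m₀ m') :
    IntegralComparisonShape Φ :=
  integralComparisonShape_of_inputs hγ Φ D t' m₀ ht htf hrk hχ hL hRoh
    (pow_dvd_cZ_mul_of_periodPositionFieldAt D t' w' m₀ m' ht' hPP)

end PeriodPosition

end Datum

/-! ### §3 ★″ The v12 stub statement from the (F-b) input form (unit-`t` gauge) -/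

/-- ★″ **`integralComparisonSeven_of_periodPositionInputs`** — the statement of zp v12's `stub_integralComparisonSeven` (VERBATIM, as in
the tree's ★ `integralComparisonSeven_of_inputs`) from the SAME existential input form with its last conjunct `Φ.π ^ (m₀ + 2 * D.jα) ∣ D.cZ * t′`
replaced by `IsUnit Φ.t ∧ PeriodPosition.PeriodPositionField D` — i.e. by ONE inequality `D.jα ≤ 2 * D.e + 2 * Φ.k + Φ.a` between naturals
of the datum/frame (the (F-b) pre-registration predicts EQUALITY on genuine data).  An ALTERNATIVE residual letter for the pen's v13 touch;
the choice is the pen's.  CONDITIONAL; nothing asserted; no stub closes; 19945 OPEN; BSD claimed for no curve.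
[cite: Kato2004Asterisque, §15.16 (15.16.1) (p. 265), 15.14 (p. 264), Prop. 15.9 (p. 258), Thm. 12.4 (2) / 12.5 (1) (p. 221)] -/
theorem integralComparisonSeven_of_periodPositionInputs
    (h : exists_zetaClassPosition_of_rank_le_one → rank_eq_analyticRank_of_analyticRank_le_one →
      ∀ (W : WeierstrassCurve ℚ) [W.IsElliptic] [W.IsGloballyMinimal] [Fact (Nat.Prime 7)], X12.ClassCSeven W →
      letI : ContinuousSMul ℤ_[7] (W.tateModule 7) := TateModule.continuousSMul_padicInt
      ∀ (K : ZpExtension ℚ 7) (hK : K.IsCyclotomic) (γ : Field.absoluteGaloisGroup ℚ) (hγ : K.IsTopGenerator γ)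
        (I : IwasawaH1Data W 7 K γ),
        ∃ (F : GenusFrame) (θu : ∀ n : ℕ, globalUnitsOf (F.layer n)), IsNormedEllipticUnitFamily F θu ∧
          ∀ d : GenusDatum F θu, ∃ Φ : PinnedKatoGenusFrame W K hK I d, ∃ D : DualExpValueDatum hγ Φ,
            ∃ (t' : Φ.R) (m₀ : ℕ), Φ.t * t' = Φ.π ^ m₀ ∧
            (∀ (f : IwasawaAlgebra 7) (x : Φ.IK.H), f ≠ 0 → f • x = 0 → x = 0) ∧
            (∀ x y : Φ.IK.H, ∃ s r₀ r₁ : IwasawaAlgebra 7,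
              (s ≠ 0 ∨ r₀ ≠ 0 ∨ r₁ ≠ 0) ∧ s • x = r₀ • y + r₁ • Φ.piK y) ∧
            (∀ n : ℕ, ∃ χ : absoluteGaloisGroup Φ.Kcm →ₜ* ℂˣ,
              (∀ σ ∈ (K.restrictOfFinrankEqTwo (by decide) Φ.Kcm Φ.finrank_Kcm).layerSubgroup (n + 1), χ σ = 1) ∧
                IsPrimitiveRoot (((χ Φ.γK : ℂˣ)) : ℂ) (7 ^ (n + 1))) ∧
            (∀ χ : absoluteGaloisGroup Φ.Kcm →ₜ* ℂˣ, ∃ Lf : ℂ → ℂ, CM.IsDepletedHeckeL Φ.ψ χ (7 * (7 * F.d)) Lf) ∧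
            (∃ n₁ : ℕ, ∀ n : ℕ, n₁ ≤ n → ∀ χ : absoluteGaloisGroup Φ.Kcm →ₜ* ℂˣ,
              (∀ σ ∈ (K.restrictOfFinrankEqTwo (by decide) Φ.Kcm Φ.finrank_Kcm).layerSubgroup (n + 1), χ σ = 1) →
              IsPrimitiveRoot (((χ Φ.γK : ℂˣ)) : ℂ) (7 ^ (n + 1)) →
              ∀ Lf : ℂ → ℂ, CM.IsDepletedHeckeL Φ.ψ χ (7 * (7 * F.d)) Lf → Lf 1 ≠ 0) ∧
            IsUnit Φ.t ∧ PeriodPosition.PeriodPositionField D) :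
    Kato2004.exists_zetaClassPosition_of_rank_le_one → rank_eq_analyticRank_of_analyticRank_le_one →
    ∀ (W : WeierstrassCurve ℚ) [W.IsElliptic] [W.IsGloballyMinimal] [Fact (Nat.Prime 7)], X12.ClassCSeven W →
      letI : ContinuousSMul ℤ_[7] (W.tateModule 7) := TateModule.continuousSMul_padicInt
      ∀ (K : ZpExtension ℚ 7) (hK : K.IsCyclotomic) (γ : Field.absoluteGaloisGroup ℚ) (_ : K.IsTopGenerator γ)
        (I : IwasawaH1Data W 7 K γ),
        ∃ (F : GenusSeven.GenusFrame) (θu : ∀ n : ℕ, globalUnitsOf (F.layer n)), GenusSeven.IsNormedEllipticUnitFamily F θu ∧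
          ∀ d : GenusSeven.GenusDatum F θu, ∃ Φ : GenusSeven.PinnedKatoGenusFrame W K hK I d,
            GenusSeven.IntegralComparisonShape Φ := by
  intro hstar hGZK W _ _ _ hC K hK γ hγ I
  haveI : ContinuousSMul ℤ_[7] (W.tateModule 7) := TateModule.continuousSMul_padicInt
  obtain ⟨F, θu, hpin, hΦ⟩ := h hstar hGZK W hC K hK γ hγ I
  refine ⟨F, θu, hpin, fun d => ?_⟩
  obtain ⟨Φ, D, t', m₀, ht, htf, hrk, hχ, hL, hRoh, htu, hPP⟩ := hΦ d
  exact ⟨Φ, PeriodPosition.integralComparisonShape_of_inputs_of_periodPositionField hγ Φ D t' m₀ ht htf hrk hχ hL hRoh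
    htu hPP⟩

end Summit.BirchSwinnertonDyer.Rank1Residual.Additive.GenusSeven
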